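import Literature.MathematicalPhysics.QuantumFieldTheory.CvitanovicKinoshita1974.SubdiagramUVLimits
import HarnessLib

/-!
# The UV limit of AHKN's `C_ij` for a subdiagram: `[U²C_jk]_UV = U_S² (U²C)^{G/S}_jk` (j, k ∉ S), `[U²C_fg]_UV = U_{G/S}² (U²C)^S_fg` (f, g ∈ S) and the MIXED rule for `C_fj` (f ∈ S, j ∉ S, self-energy S) — PROVED in the loop-matrix form (AHKN 2006 §3.3, eqs. after «When S is a self-energy subdiagram»); the mixed rule comes out with the SINGLE adjacent-line term `z_i B′^{G/S}_{ji}`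

independent recomputation; certified where stated, statistical where stated; no new-physics claim.

HONEST FRAMING (venture `QEDPrecision`, cell `qed-hepp`, seat `qed-hepp-lit` gen 4; VALUE-FREE: identities between polynomials in the entries of
arbitrary integer matrices and arbitrary parameters of a commutative ring — no graph, no integral, no number of any Set-V family). Lead's ask L4
(PLAN §6.5 NEXT «L4 second instalment (V, A_j, C_ij limits …)»), last instalment: `BuildingBlockUVLimits` (U, B_ij), `SubdiagramUVLimits` (V, A_i,
mixed B) left «NOT CLAIMED: the C_ij rules (AHKN §3.3 eqs. for [C_ij]^S_UV; the cell's generator handles them and their normalisation C vs C̃ = U·C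
differs between AHKN's text and appendix)». The cell's theory seat lists the three `C` identities among the BLOCK IDENTITIES its exponent rules rest on
(HOME/theory/BOUNDEDNESS.md §3.3 «(C1)–(C3) for U²C_ij», CITED+CHECKED by pub-qed's generator gen-02 `setvblocks/uvlimit.py` as exact polynomial
identities for all 389 Set-V families) and files an OPEN QUERY on the mixed one (§3.6 Q-T1 / GAP-T1c: gen-02 observes that the e-print's printed
second term of `[C_fj]_UV` «does NOT reproduce [U²C_fj]_{2n_S}; the single adjacent-line term z_a B′_{ja}/U_{G/S} does»). This file PROVES (C1)–(C3)
for an arbitrary `S`-adapted, path-adapted loop matrix; the kernel's (C3) is gen-02's adjacent-line form, in both its «entering» and «leaving» variants.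

SOURCE, AS PRINTED. [AoyamaEtAl2006] T. Aoyama, M. Hayakawa, T. Kinoshita, M. Nio, Nucl. Phys. B 740 (2006) 138 = arXiv:hep-ph/0512288 (`lit read
paper:arxiv-hep-ph_0512288`, LaTeX-derived chunks). §2.4 (p0008:L166–L180): «C_ij is given by C_ij = (1/U²) Σ_{k<l} z_k z_l (B′_ik B′_jl − B′_il B′_jk),
where k, l are taken from the lepton lines that belong to the path on which the momentum q^ν of the external magnetic field flows»; §2.2 (p0006:L161)
«B′_ij = B_ij − δ_ij U/z_j». §3.3 (p0012:L176–p0013:L50): «When S is a vertex subdiagram, C_ij for i or j in S have no overall UV divergence … So it is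
sufficient to consider the cases i, j ∈ G/S, in which the UV-limit of C_ij becomes [C_ij]^S_UV = (1/U_{G/S}) C^{G/S}_ij. When S is a self-energy
subdiagram, the definition (defCij) of C_ij and the UV-limits of B_ij lead to the following forms. [C_jk]^S_UV = (1/U_{G/S}) C^{G/S}_jk, j, k ∈ G/S;
[C_fg]^S_UV = (1/U_S) C^S_fg + (1/U_S)(A^S_g Σ_{h∈S} z_h B′^S_fh − A^S_f Σ_{h∈S} z_h B′^S_gh) (1/U_{G/S}) Σ_{j∈G/S} z_j B′^{G/S}_ij, f, g ∈ S;
[C_fj]^S_UV = (1/U_{G/S}) A^S_f C^{G/S}_ij + (1/U_S) Σ_{g∈S} z_g B′^S_fg (1/U_{G/S}) Σ_{k∈G/S} z_k B′^{G/S}_jk, f ∈ S, j ∈ G/S, where i is the line adjacent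
to S.»; App. «Concise formula for C_ij» (p0026:L241–p0027:L10): «C_{j₁j₂} ≡ (1/U) C̃_{j₁j₂}, C̃_{j₁j₂} = (1/U) Σ′_{k₁<k₂} z_{k₁} z_{k₂} (B′_{k₁j₁} B′_{k₂j₂} −
B′_{k₁j₂} B′_{k₂j₁})» (so the `C^X` of §3.3 is the polynomial-normalised `C̃^X = U_X·C^X`). gen-02 `route_ahkn.py` (pub-qed, read-only): «C_ij = (1/U²)
Σ_{k<l in P} z_k z_l (B′_ik B′_jl − B′_il B′_jk) (i<j lepton lines) → U²·C_ij polynomial», P = the lines carrying the external momentum (`eta ≠ 0`).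

TYPING. `WNum T z χ i k := χ_k z_k B_ik − δ_ik χ_k U` (= `z_k B′_ik` on the path `χ = 1`, `0` off it: AHKN's `W′_ik`, gen-02's `Wp`), so that
`Σ_k W_ik = −U·A_i` (`sum_WNum`, with `ANum` of `SubdiagramIRLimits`); `CNum T z χ lt i j := Σ_{k,l : lt k l} (W_ik W_jl − W_il W_jk) = U²·C_ij` for a
path order `lt` («k < l»). Subdiagram setting as in `SubdiagramUVLimits`: blocks `TI, TOS, TOO`, `n_S = |κI| ≥ 1`, scaling `scaledZ zS zO ε`, incidence
`uvχ χS χO`, `PathAdapted TOS TOO a ηS` (self-energy `S` inserted in the outer line `a`; `χS = η`). The path order on `μS ⊕ μO` is `adLt pre`: the given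
linear orders inside `S` and inside `G/S`, the lines of `S` forming ONE CONTIGUOUS BLOCK, the outer line `k` preceding the block iff `pre k` — the
situation of a self-energy insertion on a lepton path; (C3) is stated for the block right after the pivot (`pre k ↔ k ≤ a`: `a` = the line ENTERING `S`)
and right before it (`pre k ↔ k < a`: `a` = the line LEAVING `S`); (C1), (C2) hold for any `pre`.
PROVED (0 named facts). `WNum_adapted` (`W_ik(ε) = ε^{n_S} wCof(ε) i k`), `CNum_adapted` (`U²C_ij(ε) = ε^{2n_S} cCof(ε) i j` — the ORDER «U²C = O(ε^{2n_S})»,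
gen-02's «no part of U²C of eps-degree < 2n_S exists» as a lower bound); the leading table `wCof_zero_inl_inl` (`U_{G/S}·W^S`), `wCof_zero_inr_inl` (`0`),
`wCof_zero_inr_inr` (`U_S·W^{G/S}`), `wCof_zero_inl_inr` (path-adapted: `χ_k z_k B^{G/S}_{ak}·(U_S A^S_f)`); and the three rules as LEADING COEFFICIENTS:
**(C2) `cCof_zero_inr_inr`: `[U²C_jk]_{2n_S} = U_S² · (U²C)^{G/S}_jk`** (any adapted `S`; = printed «[C_jk]_UV = (1/U_{G/S}) C̃^{G/S}_jk»);
**(C1) `cCof_zero_inl_inl`: `[U²C_fg]_{2n_S} = U_{G/S}² · (U²C)^S_fg`** (path-adapted `S`; = printed first term, the printed additional term vanishing since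
`Σ_h z_h B′^S_fh = −U_S A^S_f` — `sum_WNum`); **(C3) `cCof_zero_inl_inr_pre`** (general block position), **`cCof_zero_inl_inr`: `[U²C_fj]_{2n_S} =
U_S·(U_S A^S_f)·((U²C)^{G/S}_{aj} + U_{G/S}·W^{G/S}_{ja})`** for the block right after `a` (entering line), **`cCof_zero_inl_inr'`: `… = U_S·(U_S A^S_f)·
((U²C)^{G/S}_{aj} − U_{G/S}·W^{G/S}_{ja})`** for the block right before `a` (leaving line), `χ_a = 1`, `W^{G/S}_{ja} = z_a B′^{G/S}_{ja}` — gen-02's two forms.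
READING (⟦lit⟧, the one sentence beyond the sources): dividing by `[U²]_{2n_S} = U_S² U_{G/S}²` and using `(1/U_S) Σ_{g∈S} z_g B′^S_fg = −A^S_f`, the LEAVING
form reads `[C_fj]_UV = (1/U_{G/S}) A^S_f C̃^{G/S}_{ij} + (1/U_S) Σ_{g∈S} z_g B′^S_fg · (1/U_{G/S}) z_i B′^{G/S}_{ji}` with `i` the line leaving `S` — the printed (C3)
with its last factor `Σ_{k∈G/S} z_k B′^{G/S}_{jk}` replaced by its single term `k = i` (gen-02's observation «the single adjacent-line term reproduces it», now
a kernel theorem for every adapted loop matrix); with `i` the entering line the same term enters with the opposite sign. Whether the e-print's `Σ_{k∈G/S}` is a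
misprint is not decidable from the text and is recorded as a discrepancy, not asserted.
NOT CLAIMED: the magnetic-moment projection in which `C_ij` occurs, vertex-type `S` beyond (C2), anything about amplitudes; the per-word dictionary is
`QTypeLoopMatrix` (`loopT_reindex`, `pathAdapted_left/right`).
-/

namespace Literature.MathematicalPhysics.QuantumFieldTheory.AoyamaEtAl2006

open Matrix Finset
open Literature.MathematicalPhysics.QuantumFieldTheory.CvitanovicKinoshita1974

/-! ## `W′_ik = z_k B′_ik` and `U² C_ij` in the loop-matrix form -/

section General

variable {R : Type*} [CommRing R] {κ μ : Type*} [Fintype κ] [Fintype μ] [DecidableEq κ] [DecidableEq μ]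

/-- `W_ik := χ_k z_k B_ik − δ_ik χ_k U` — on the momentum path (`χ_k = 1`) this is AHKN's `z_k B′_ik` with `B′_ik = B_ik − δ_ik U/z_k`, off the path it
is `0`. [cite: AoyamaEtAl2006, §2.2 (eq. for B′_ij) and §2.4 (eq. defCij)] -/
def WNum (T : Matrix κ μ ℤ) (z χ : μ → R) (i k : μ) : R :=
  χ k * z k * BAdj T z i k - if i = k then χ k * UDet T z else 0

/-- `U²·C_ij := Σ_{k<l} (W_ik W_jl − W_il W_jk)` («C_ij = (1/U²) Σ_{k<l} z_k z_l (B′_ik B′_jl − B′_il B′_jk), where k, l are taken from the lepton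
lines that belong to the path»), for a path order `lt`. [cite: AoyamaEtAl2006, §2.4 (eq. defCij)] -/
def CNum (T : Matrix κ μ ℤ) (z χ : μ → R) (lt : μ → μ → Prop) [DecidableRel lt] (i j : μ) : R :=
  ∑ k, ∑ l, if lt k l then WNum T z χ i k * WNum T z χ j l - WNum T z χ i l * WNum T z χ j k else 0

/-- `Σ_k W_ik = −U·A_i` («A_i = −(1/U) Σ_j η_{jP} z_j B′_ji»). [cite: AoyamaEtAl2006, §2.2 (eq. for the scalar current A_i)] -/
theorem sum_WNum (T : Matrix κ μ ℤ) (z χ : μ → R) (i : μ) : ∑ k, WNum T z χ i k = -ANum T z χ i := by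
  simp only [WNum, Finset.sum_sub_distrib, Finset.sum_ite_eq, Finset.mem_univ, if_true, ANum]
  ring

end General

/-! ## The UV scaling of `W` and `U²C` for an `S`-adapted loop matrix -/

section UV

variable {R : Type*} [CommRing R]
variable {κI κO μS μO : Type*} [Fintype κI] [Fintype κO] [Fintype μS] [Fintype μO] [DecidableEq κI] [DecidableEq κO]
  [LinearOrder μS] [LinearOrder μO]
variable (TI : Matrix κI μS ℤ) (TOS : Matrix κO μS ℤ) (TOO : Matrix κO μO ℤ) (zS : μS → R) (zO : μO → R)
  (χS : μS → R) (χO : μO → R)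

/-- The cofactor of `W_ik` under the UV scaling: `W_ik(ε) = ε^{n_S} · wCof(ε) i k`. [cite: AoyamaEtAl2006, §3.3 (UV limits of B_ij)] -/
def wCof (ε : R) (i : μS ⊕ μO) : μS ⊕ μO → R
  | Sum.inl k => χS k * zS k * cofBS TI TOS TOO zS zO ε i k - if i = Sum.inl k then χS k * (cofMat TI TOS TOO zS zO ε).det else 0
  | Sum.inr k => χO k * zO k * cofBO TI TOS TOO zS zO ε i k - if i = Sum.inr k then χO k * (cofMat TI TOS TOO zS zO ε).det else 0

/-- **`W_ik = O(ε^{n_S})`**: `W_ik(ε) = ε^{n_S} · wCof(ε) i k` for every pair of lines (`n_S ≥ 1`). [cite: AoyamaEtAl2006, §3.1 and §3.3] -/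
theorem WNum_adapted (hI : 0 < Fintype.card κI) (ε : R) (i k : μS ⊕ μO) :
    WNum (adaptedT TI TOS TOO) (scaledZ zS zO ε) (uvχ χS χO) i k = ε ^ Fintype.card κI * wCof TI TOS TOO zS zO χS χO ε i k := by
  have hpow : ε * ε ^ (Fintype.card κI - 1) = ε ^ Fintype.card κI := by
    rw [← pow_succ', Nat.sub_add_cancel hI]
  rcases k with k | k
  · rw [WNum, BAdj_adapted_inl TI TOS TOO zS zO hI, UDet_adapted, wCof]
    simp only [uvχ, scaledZ, Sum.elim_inl]
    by_cases h : i = Sum.inl k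
    · rw [if_pos h, if_pos h, ← hpow]; ring
    · rw [if_neg h, if_neg h, ← hpow]; ring
  · rw [WNum, BAdj_adapted_inr, UDet_adapted, wCof]
    simp only [uvχ, scaledZ, Sum.elim_inr]
    by_cases h : i = Sum.inr k
    · rw [if_pos h, if_pos h]; ring
    · rw [if_neg h, if_neg h]; ring

variable (pre : μO → Prop) [DecidablePred pre]

/-- The path order on `μS ⊕ μO` when the lines of `S` form ONE CONTIGUOUS BLOCK of the path (a self-energy insertion): inside `S` and inside `G/S` the
given orders; the outer line `k` precedes the block iff `pre k`. [cite: AoyamaEtAl2006, §3.3 («where i is the line adjacent to S»)] -/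
def adLt : μS ⊕ μO → μS ⊕ μO → Prop
  | Sum.inl k, Sum.inl l => k < l
  | Sum.inr k, Sum.inr l => k < l
  | Sum.inr k, Sum.inl _ => pre k
  | Sum.inl _, Sum.inr l => ¬ pre l

/-- `adLt` is decidable. [folklore] -/
instance instDecidableRelAdLt : DecidableRel (adLt (μS := μS) pre) := fun k l => by
  rcases k with k | k <;> rcases l with l | l <;> unfold adLt <;> infer_instance

omit [Fintype μS] [Fintype μO] [DecidablePred pre] in
/-- Order inside `S`. [cite: AoyamaEtAl2006, §2.4 (eq. defCij, «k < l»)] -/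
@[simp] theorem adLt_inl_inl (k l : μS) : adLt pre (Sum.inl k) (Sum.inl l) ↔ k < l := Iff.rfl
omit [Fintype μS] [Fintype μO] [DecidablePred pre] in
/-- Order inside `G/S`. [cite: AoyamaEtAl2006, §2.4 (eq. defCij, «k < l»)] -/
@[simp] theorem adLt_inr_inr (k l : μO) : adLt (μS := μS) pre (Sum.inr k) (Sum.inr l) ↔ k < l := Iff.rfl
omit [Fintype μS] [Fintype μO] [DecidablePred pre] in
/-- An outer line before the block. [cite: AoyamaEtAl2006, §3.3] -/
@[simp] theorem adLt_inr_inl (k : μO) (l : μS) : adLt pre (Sum.inr k) (Sum.inl l) ↔ pre k := Iff.rfl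
omit [Fintype μS] [Fintype μO] [DecidablePred pre] in
/-- An outer line after the block. [cite: AoyamaEtAl2006, §3.3] -/
@[simp] theorem adLt_inl_inr (k : μS) (l : μO) : adLt pre (Sum.inl k) (Sum.inr l) ↔ ¬ pre l := Iff.rfl

/-- The cofactor of `U²C_ij` under the UV scaling. [cite: AoyamaEtAl2006, §3.3 (UV limits of C_ij)] -/
def cCof (ε : R) (i j : μS ⊕ μO) : R :=
  ∑ k, ∑ l, if adLt pre k l then
    wCof TI TOS TOO zS zO χS χO ε i k * wCof TI TOS TOO zS zO χS χO ε j l - wCof TI TOS TOO zS zO χS χO ε i l * wCof TI TOS TOO zS zO χS χO ε j k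
    else 0

/-- **`U²C_ij = O(ε^{2n_S})`**: `U²C_ij(ε) = ε^{2n_S} · cCof(ε) i j` for every pair of lines (gen-02: «no part of U²C of eps-degree < 2n_S exists» — the
lower bound). [cite: AoyamaEtAl2006, §3.3 (UV limits of C_ij)] -/
theorem CNum_adapted (hI : 0 < Fintype.card κI) (ε : R) (i j : μS ⊕ μO) :
    CNum (adaptedT TI TOS TOO) (scaledZ zS zO ε) (uvχ χS χO) (adLt pre) i j =
      ε ^ (2 * Fintype.card κI) * cCof TI TOS TOO zS zO χS χO pre ε i j := by
  rw [CNum, cCof, Finset.mul_sum]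
  refine Finset.sum_congr rfl fun k _ => ?_
  rw [Finset.mul_sum]
  refine Finset.sum_congr rfl fun l _ => ?_
  simp only [WNum_adapted TI TOS TOO zS zO χS χO hI]
  split_ifs
  · ring
  · ring

/-! ### The leading coefficients of `W` -/

/-- Inner row, inner column: `wCof(0) (f ∈ S) (k ∈ S) = U_{G/S} · W^S_fk`. [cite: AoyamaEtAl2006, §3.3 (eq. [B_ij]_UV = B^S_ij U_{G/S})] -/
theorem wCof_zero_inl_inl (f k : μS) :
    wCof TI TOS TOO zS zO χS χO 0 (Sum.inl f) (Sum.inl k) = UDet TOO zO * WNum TI zS χS f k := by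
  rw [wCof, cofBS_zero, det_cofMat_zero, WNum]
  by_cases h : f = k
  · subst h; simp only [if_true]; ring
  · rw [if_neg (fun h' => h (Sum.inl_injective h')), if_neg h]; ring

/-- Outer row, inner column: `wCof(0) (j ∉ S) (l ∈ S) = 0` (the mixed `B_jl` is `O(ε^{n_S})`, one order above `z_l = O(ε)`'s partner).
[cite: AoyamaEtAl2006, §3.1 («B_ij = O(ε^{n_S}) otherwise»)] -/
theorem wCof_zero_inr_inl (j : μO) (l : μS) : wCof TI TOS TOO zS zO χS χO 0 (Sum.inr j) (Sum.inl l) = 0 := by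
  rw [wCof, cofBS_zero_outer, if_neg Sum.inr_ne_inl]
  ring

/-- Outer row, outer column: `wCof(0) (j ∉ S) (l ∉ S) = U_S · W^{G/S}_jl`. [cite: AoyamaEtAl2006, §3.3 (eq. [B_ij]_UV = B^{G/S}_ij U_S)] -/
theorem wCof_zero_inr_inr (j l : μO) :
    wCof TI TOS TOO zS zO χS χO 0 (Sum.inr j) (Sum.inr l) = UDet TI zS * WNum TOO zO χO j l := by
  rw [wCof, cofBO_zero, det_cofMat_zero, WNum]
  by_cases h : j = l
  · subst h; simp only [if_true]; ring
  · rw [if_neg (fun h' => h (Sum.inr_injective h')), if_neg h]; ring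

/-- Inner row, outer column, PATH-ADAPTED `S` in line `a`: `wCof(0) (f ∈ S) (k ∉ S) = χ_k z_k B^{G/S}_{ak} · (U_S A^S_f)` (from (2.14)).
[cite: AoyamaEtAl2006, §3.3 (eq. [B_mj]_UV = B^{G/S}_ij A^S_m U_S)] -/
theorem wCof_zero_inl_inr {a : μO} {ηS : μS → ℤ} (hT : PathAdapted TOS TOO a ηS) (f : μS) (k : μO) :
    wCof TI TOS TOO zS zO (fun b => (ηS b : R)) χO 0 (Sum.inl f) (Sum.inr k) =
      χO k * zO k * BAdj TOO zO a k * ANum TI zS (fun b => (ηS b : R)) f := by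
  rw [wCof, cofBO_zero_inl_of_pathAdapted TI TOS TOO zS zO hT, if_neg Sum.inl_ne_inr]
  ring

/-! ### The four blocks of the path order -/

/-- `cCof` split along `μS ⊕ μO` into its four blocks (lines of `S` × lines of `S`, `S` × outer-after-`a`, outer-up-to-`a` × `S`, outer × outer).
[cite: AoyamaEtAl2006, §3.3 (UV limits of C_ij: the cases f, g ∈ S / j, k ∈ G/S / f ∈ S, j ∈ G/S)] -/
theorem cCof_eq_blocks (ε : R) (i j : μS ⊕ μO) :
    cCof TI TOS TOO zS zO χS χO pre ε i j =
      (∑ k : μS, ∑ l : μS, if k < l then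
          wCof TI TOS TOO zS zO χS χO ε i (Sum.inl k) * wCof TI TOS TOO zS zO χS χO ε j (Sum.inl l) - wCof TI TOS TOO zS zO χS χO ε i (Sum.inl l) * wCof TI TOS TOO zS zO χS χO ε j (Sum.inl k) else 0) +
      (∑ k : μS, ∑ l : μO, if ¬ pre l then
          wCof TI TOS TOO zS zO χS χO ε i (Sum.inl k) * wCof TI TOS TOO zS zO χS χO ε j (Sum.inr l) - wCof TI TOS TOO zS zO χS χO ε i (Sum.inr l) * wCof TI TOS TOO zS zO χS χO ε j (Sum.inl k) else 0) +
      ((∑ k : μO, ∑ l : μS, if pre k then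
          wCof TI TOS TOO zS zO χS χO ε i (Sum.inr k) * wCof TI TOS TOO zS zO χS χO ε j (Sum.inl l) - wCof TI TOS TOO zS zO χS χO ε i (Sum.inl l) * wCof TI TOS TOO zS zO χS χO ε j (Sum.inr k) else 0) +
      (∑ k : μO, ∑ l : μO, if k < l then
          wCof TI TOS TOO zS zO χS χO ε i (Sum.inr k) * wCof TI TOS TOO zS zO χS χO ε j (Sum.inr l) - wCof TI TOS TOO zS zO χS χO ε i (Sum.inr l) * wCof TI TOS TOO zS zO χS χO ε j (Sum.inr k) else 0)) := by
  simp only [cCof, Fintype.sum_sum_type, Finset.sum_add_distrib, adLt_inl_inl, adLt_inl_inr, adLt_inr_inl, adLt_inr_inr]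
  ring

/-! ### (C2): `j, k ∉ S` — any adapted `S` -/

/-- **(C2) «[C_jk]^S_UV = (1/U_{G/S}) C̃^{G/S}_jk, j, k ∈ G/S»**: `[U²C_jk]_{2n_S} = U_S² · (U²C)^{G/S}_jk` — for every `S`-adapted loop matrix (self-energy or
vertex `S`), any position of the block. [cite: AoyamaEtAl2006, §3.3 (eqs. [C_ij]_UV for i, j ∈ G/S)] -/
theorem cCof_zero_inr_inr (j j' : μO) :
    cCof TI TOS TOO zS zO χS χO pre 0 (Sum.inr j) (Sum.inr j') = UDet TI zS ^ 2 * CNum TOO zO χO (· < ·) j j' := by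
  rw [cCof_eq_blocks, CNum]
  simp only [wCof_zero_inr_inl, wCof_zero_inr_inr, zero_mul, mul_zero, sub_zero, ite_self, Finset.sum_const_zero, zero_add, Finset.mul_sum]
  refine Finset.sum_congr rfl fun k _ => Finset.sum_congr rfl fun l _ => ?_
  split_ifs
  · ring
  · ring

/-! ### (C1): `f, g ∈ S` — path-adapted `S` -/

/-- **(C1) «[C_fg]^S_UV = (1/U_S) C̃^S_fg + (vanishing term)», `f, g ∈ S`**: `[U²C_fg]_{2n_S} = U_{G/S}² · (U²C)^S_fg` for a path-adapted `S` (the printed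
additional term `(A^S_g Σ_h z_h B′^S_fh − A^S_f Σ_h z_h B′^S_gh)(…)` vanishes identically because `Σ_{h∈S} z_h B′^S_fh = −U_S A^S_f`).
[cite: AoyamaEtAl2006, §3.3 (eq. [C_fg]_UV, f, g ∈ S)] -/
theorem cCof_zero_inl_inl {a : μO} {ηS : μS → ℤ} (hT : PathAdapted TOS TOO a ηS) (f g : μS) :
    cCof TI TOS TOO zS zO (fun b => (ηS b : R)) χO pre 0 (Sum.inl f) (Sum.inl g) =
      UDet TOO zO ^ 2 * CNum TI zS (fun b => (ηS b : R)) (· < ·) f g := by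
  have hA := sum_WNum TI zS (fun b => (ηS b : R))
  have hSS : (∑ k : μS, ∑ l : μS, if k < l then
      wCof TI TOS TOO zS zO (fun b => (ηS b : R)) χO 0 (Sum.inl f) (Sum.inl k) * wCof TI TOS TOO zS zO (fun b => (ηS b : R)) χO 0 (Sum.inl g) (Sum.inl l) -
        wCof TI TOS TOO zS zO (fun b => (ηS b : R)) χO 0 (Sum.inl f) (Sum.inl l) * wCof TI TOS TOO zS zO (fun b => (ηS b : R)) χO 0 (Sum.inl g) (Sum.inl k) else 0) =
      UDet TOO zO ^ 2 * CNum TI zS (fun b => (ηS b : R)) (· < ·) f g := by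
    rw [CNum, Finset.mul_sum]
    refine Finset.sum_congr rfl fun k _ => ?_
    rw [Finset.mul_sum]
    refine Finset.sum_congr rfl fun l _ => ?_
    simp only [wCof_zero_inl_inl]
    split_ifs
    · ring
    · ring
  have hSO : (∑ k : μS, ∑ l : μO, if ¬ pre l then
      wCof TI TOS TOO zS zO (fun b => (ηS b : R)) χO 0 (Sum.inl f) (Sum.inl k) * wCof TI TOS TOO zS zO (fun b => (ηS b : R)) χO 0 (Sum.inl g) (Sum.inr l) -
        wCof TI TOS TOO zS zO (fun b => (ηS b : R)) χO 0 (Sum.inl f) (Sum.inr l) * wCof TI TOS TOO zS zO (fun b => (ηS b : R)) χO 0 (Sum.inl g) (Sum.inl k) else 0) = 0 := by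
    rw [Finset.sum_comm]
    refine Finset.sum_eq_zero fun l _ => ?_
    by_cases hl : ¬ pre l
    · simp only [if_pos hl, wCof_zero_inl_inl, wCof_zero_inl_inr TI TOS TOO zS zO χO hT]
      have h1 : ∀ k : μS, UDet TOO zO * WNum TI zS (fun b => (ηS b : R)) f k * (χO l * zO l * BAdj TOO zO a l * ANum TI zS (fun b => (ηS b : R)) g) -
          χO l * zO l * BAdj TOO zO a l * ANum TI zS (fun b => (ηS b : R)) f * (UDet TOO zO * WNum TI zS (fun b => (ηS b : R)) g k) =
          UDet TOO zO * χO l * zO l * BAdj TOO zO a l * ANum TI zS (fun b => (ηS b : R)) g * WNum TI zS (fun b => (ηS b : R)) f k -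
          UDet TOO zO * χO l * zO l * BAdj TOO zO a l * ANum TI zS (fun b => (ηS b : R)) f * WNum TI zS (fun b => (ηS b : R)) g k :=
        fun k => by ring
      simp only [h1]
      rw [Finset.sum_sub_distrib, ← Finset.mul_sum, ← Finset.mul_sum, hA, hA]
      ring
    · simp only [if_neg hl, Finset.sum_const_zero]
  have hOS : (∑ k : μO, ∑ l : μS, if pre k then
      wCof TI TOS TOO zS zO (fun b => (ηS b : R)) χO 0 (Sum.inl f) (Sum.inr k) * wCof TI TOS TOO zS zO (fun b => (ηS b : R)) χO 0 (Sum.inl g) (Sum.inl l) -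
        wCof TI TOS TOO zS zO (fun b => (ηS b : R)) χO 0 (Sum.inl f) (Sum.inl l) * wCof TI TOS TOO zS zO (fun b => (ηS b : R)) χO 0 (Sum.inl g) (Sum.inr k) else 0) = 0 := by
    refine Finset.sum_eq_zero fun k _ => ?_
    by_cases hk : pre k
    · simp only [if_pos hk, wCof_zero_inl_inl, wCof_zero_inl_inr TI TOS TOO zS zO χO hT]
      have h1 : ∀ l : μS, χO k * zO k * BAdj TOO zO a k * ANum TI zS (fun b => (ηS b : R)) f * (UDet TOO zO * WNum TI zS (fun b => (ηS b : R)) g l) -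
          UDet TOO zO * WNum TI zS (fun b => (ηS b : R)) f l * (χO k * zO k * BAdj TOO zO a k * ANum TI zS (fun b => (ηS b : R)) g) =
          UDet TOO zO * χO k * zO k * BAdj TOO zO a k * ANum TI zS (fun b => (ηS b : R)) f * WNum TI zS (fun b => (ηS b : R)) g l -
          UDet TOO zO * χO k * zO k * BAdj TOO zO a k * ANum TI zS (fun b => (ηS b : R)) g * WNum TI zS (fun b => (ηS b : R)) f l :=
        fun l => by ring
      simp only [h1]
      rw [Finset.sum_sub_distrib, ← Finset.mul_sum, ← Finset.mul_sum, hA, hA]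
      ring
    · simp only [if_neg hk, Finset.sum_const_zero]
  have hOO : (∑ k : μO, ∑ l : μO, if k < l then
      wCof TI TOS TOO zS zO (fun b => (ηS b : R)) χO 0 (Sum.inl f) (Sum.inr k) * wCof TI TOS TOO zS zO (fun b => (ηS b : R)) χO 0 (Sum.inl g) (Sum.inr l) -
        wCof TI TOS TOO zS zO (fun b => (ηS b : R)) χO 0 (Sum.inl f) (Sum.inr l) * wCof TI TOS TOO zS zO (fun b => (ηS b : R)) χO 0 (Sum.inl g) (Sum.inr k) else 0) = 0 := by
    refine Finset.sum_eq_zero fun k _ => Finset.sum_eq_zero fun l _ => ?_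
    simp only [wCof_zero_inl_inr TI TOS TOO zS zO χO hT]
    split_ifs
    · ring
    · rfl
  rw [cCof_eq_blocks, hSS, hSO, hOS, hOO]
  ring

/-! ### (C3): `f ∈ S`, `j ∉ S` — path-adapted self-energy `S` in the line `a` -/

/-- (C3), general position of the block: the leading coefficient of the mixed `U²C_fj` in terms of the reduced diagram's `C`, boundary sums at the
pivot `a` and at the block. [cite: AoyamaEtAl2006, §3.3 (eq. [C_fj]_UV, f ∈ S, j ∈ G/S)] -/
theorem cCof_zero_inl_inr_pre {a : μO} {ηS : μS → ℤ} (hT : PathAdapted TOS TOO a ηS) (hχa : χO a = 1) (f : μS) (j : μO) :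
    cCof TI TOS TOO zS zO (fun b => (ηS b : R)) χO pre 0 (Sum.inl f) (Sum.inr j) =
      UDet TI zS * ANum TI zS (fun b => (ηS b : R)) f *
        (CNum TOO zO χO (· < ·) a j +
          UDet TOO zO * ((∑ l : μO, (if a < l then WNum TOO zO χO j l else 0)) - (∑ k : μO, (if k < a then WNum TOO zO χO j k else 0)) +
            (∑ k : μO, (if pre k then WNum TOO zO χO j k else 0)) - ∑ l : μO, (if ¬ pre l then WNum TOO zO χO j l else 0))) := by
  set A := ANum TI zS (fun b => (ηS b : R)) f with hAdef
  have hA : ∑ l : μS, WNum TI zS (fun b => (ηS b : R)) f l = -A := sum_WNum TI zS (fun b => (ηS b : R)) f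
  -- block (S, S): every term carries an outer-row/inner-column factor, which vanishes
  have hSS : (∑ k : μS, ∑ l : μS, if k < l then
      wCof TI TOS TOO zS zO (fun b => (ηS b : R)) χO 0 (Sum.inl f) (Sum.inl k) * wCof TI TOS TOO zS zO (fun b => (ηS b : R)) χO 0 (Sum.inr j) (Sum.inl l) -
        wCof TI TOS TOO zS zO (fun b => (ηS b : R)) χO 0 (Sum.inl f) (Sum.inl l) * wCof TI TOS TOO zS zO (fun b => (ηS b : R)) χO 0 (Sum.inr j) (Sum.inl k) else 0) = 0 := by
    refine Finset.sum_eq_zero fun k _ => Finset.sum_eq_zero fun l _ => ?_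
    simp only [wCof_zero_inr_inl, mul_zero, sub_self, ite_self]
  -- block (S, O after the block): = -U_Q U_S A · Σ_{¬pre l} W^Q_jl
  have hSO : (∑ k : μS, ∑ l : μO, if ¬ pre l then
      wCof TI TOS TOO zS zO (fun b => (ηS b : R)) χO 0 (Sum.inl f) (Sum.inl k) * wCof TI TOS TOO zS zO (fun b => (ηS b : R)) χO 0 (Sum.inr j) (Sum.inr l) -
        wCof TI TOS TOO zS zO (fun b => (ηS b : R)) χO 0 (Sum.inl f) (Sum.inr l) * wCof TI TOS TOO zS zO (fun b => (ηS b : R)) χO 0 (Sum.inr j) (Sum.inl k) else 0) =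
      -(UDet TOO zO * UDet TI zS * A) * ∑ l : μO, (if ¬ pre l then WNum TOO zO χO j l else 0) := by
    rw [Finset.sum_comm, Finset.mul_sum]
    refine Finset.sum_congr rfl fun l _ => ?_
    by_cases hl : ¬ pre l
    · simp only [if_pos hl, wCof_zero_inl_inl, wCof_zero_inr_inr, wCof_zero_inr_inl, mul_zero, sub_zero]
      have h1 : ∀ k : μS, UDet TOO zO * WNum TI zS (fun b => (ηS b : R)) f k * (UDet TI zS * WNum TOO zO χO j l) =
          UDet TOO zO * UDet TI zS * WNum TOO zO χO j l * WNum TI zS (fun b => (ηS b : R)) f k := fun k => by ring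
      simp only [h1]
      rw [← Finset.mul_sum, hA]
      ring
    · simp only [if_neg hl, Finset.sum_const_zero, mul_zero]
  -- block (O before the block, S): = U_Q U_S A · Σ_{pre k} W^Q_jk
  have hOS : (∑ k : μO, ∑ l : μS, if pre k then
      wCof TI TOS TOO zS zO (fun b => (ηS b : R)) χO 0 (Sum.inl f) (Sum.inr k) * wCof TI TOS TOO zS zO (fun b => (ηS b : R)) χO 0 (Sum.inr j) (Sum.inl l) -
        wCof TI TOS TOO zS zO (fun b => (ηS b : R)) χO 0 (Sum.inl f) (Sum.inl l) * wCof TI TOS TOO zS zO (fun b => (ηS b : R)) χO 0 (Sum.inr j) (Sum.inr k) else 0) =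
      UDet TOO zO * UDet TI zS * A * ∑ k : μO, (if pre k then WNum TOO zO χO j k else 0) := by
    rw [Finset.mul_sum]
    refine Finset.sum_congr rfl fun k _ => ?_
    by_cases hk : pre k
    · simp only [if_pos hk, wCof_zero_inl_inl, wCof_zero_inr_inr, wCof_zero_inr_inl, mul_zero, zero_sub]
      have h1 : ∀ l : μS, -(UDet TOO zO * WNum TI zS (fun b => (ηS b : R)) f l * (UDet TI zS * WNum TOO zO χO j k)) =
          -(UDet TOO zO * UDet TI zS * WNum TOO zO χO j k) * WNum TI zS (fun b => (ηS b : R)) f l := fun l => by ring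
      simp only [h1]
      rw [← Finset.mul_sum, hA]
      ring
    · simp only [if_neg hk, Finset.sum_const_zero, mul_zero]
  -- block (O, O): χ_k z_k B^Q_ak = W^Q_ak + δ_ak χ_a U_Q; the δ-terms leave boundary sums at the pivot
  have hB : ∀ k : μO, χO k * zO k * BAdj TOO zO a k = WNum TOO zO χO a k + if a = k then χO k * UDet TOO zO else 0 := fun k => by
    rw [WNum]
    by_cases hk : a = k
    · subst hk; simp only [if_true]; ring
    · simp only [if_neg hk]; ring
  have h2 : ∑ k : μO, ∑ l : μO, (if k < l then (if a = k then χO k * UDet TOO zO else 0) * WNum TOO zO χO j l else 0) =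
      UDet TOO zO * ∑ l : μO, (if a < l then WNum TOO zO χO j l else 0) := by
    have h3 : ∀ k : μO, ∑ l : μO, (if k < l then (if a = k then χO k * UDet TOO zO else 0) * WNum TOO zO χO j l else 0) =
        if a = k then ∑ l : μO, (if k < l then UDet TOO zO * WNum TOO zO χO j l else 0) else 0 := by
      intro k
      by_cases hk : a = k
      · subst hk; simp only [if_true, hχa, one_mul]
      · simp only [if_neg hk, zero_mul, ite_self, Finset.sum_const_zero]
    simp only [h3, Finset.sum_ite_eq, Finset.mem_univ, if_true, Finset.mul_sum]
    refine Finset.sum_congr rfl fun l _ => ?_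
    split_ifs <;> simp
  have h4 : ∑ k : μO, ∑ l : μO, (if k < l then (if a = l then χO l * UDet TOO zO else 0) * WNum TOO zO χO j k else 0) =
      UDet TOO zO * ∑ k : μO, (if k < a then WNum TOO zO χO j k else 0) := by
    have h5 : ∀ k l : μO, (if k < l then (if a = l then χO l * UDet TOO zO else 0) * WNum TOO zO χO j k else 0) =
        if a = l then (if k < l then UDet TOO zO * WNum TOO zO χO j k else 0) else 0 := by
      intro k l
      by_cases hl : a = l
      · subst hl; simp only [if_true, hχa, one_mul]
      · simp only [if_neg hl, zero_mul, ite_self]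
    simp only [h5, Finset.sum_ite_eq, Finset.mem_univ, if_true, Finset.mul_sum]
    refine Finset.sum_congr rfl fun k _ => ?_
    split_ifs <;> simp
  have hOO : (∑ k : μO, ∑ l : μO, if k < l then
      wCof TI TOS TOO zS zO (fun b => (ηS b : R)) χO 0 (Sum.inl f) (Sum.inr k) * wCof TI TOS TOO zS zO (fun b => (ηS b : R)) χO 0 (Sum.inr j) (Sum.inr l) -
        wCof TI TOS TOO zS zO (fun b => (ηS b : R)) χO 0 (Sum.inl f) (Sum.inr l) * wCof TI TOS TOO zS zO (fun b => (ηS b : R)) χO 0 (Sum.inr j) (Sum.inr k) else 0) =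
      UDet TI zS * A * (CNum TOO zO χO (· < ·) a j +
        (UDet TOO zO * ∑ l : μO, (if a < l then WNum TOO zO χO j l else 0)) -
          UDet TOO zO * ∑ k : μO, (if k < a then WNum TOO zO χO j k else 0)) := by
    have h6 : ∀ k l : μO, (if k < l then
        wCof TI TOS TOO zS zO (fun b => (ηS b : R)) χO 0 (Sum.inl f) (Sum.inr k) * wCof TI TOS TOO zS zO (fun b => (ηS b : R)) χO 0 (Sum.inr j) (Sum.inr l) -
          wCof TI TOS TOO zS zO (fun b => (ηS b : R)) χO 0 (Sum.inl f) (Sum.inr l) * wCof TI TOS TOO zS zO (fun b => (ηS b : R)) χO 0 (Sum.inr j) (Sum.inr k) else 0) =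
        UDet TI zS * A * ((if k < l then WNum TOO zO χO a k * WNum TOO zO χO j l - WNum TOO zO χO a l * WNum TOO zO χO j k else 0)
          + ((if k < l then (if a = k then χO k * UDet TOO zO else 0) * WNum TOO zO χO j l else 0)
          - (if k < l then (if a = l then χO l * UDet TOO zO else 0) * WNum TOO zO χO j k else 0))) := by
      intro k l
      rw [wCof_zero_inl_inr TI TOS TOO zS zO χO hT, wCof_zero_inl_inr TI TOS TOO zS zO χO hT, wCof_zero_inr_inr, wCof_zero_inr_inr,
        ← hAdef, hB k, hB l]
      split_ifs <;> ring
    simp only [h6, ← Finset.mul_sum, Finset.sum_add_distrib, Finset.sum_sub_distrib]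
    rw [h2, h4, CNum]
    ring
  rw [cCof_eq_blocks, hSS, hSO, hOS, hOO]
  ring

/-- `Σ_{k ≤ a} = Σ_{k < a} + (k = a)`. [folklore] -/
private theorem sum_ite_le_eq (a : μO) (F : μO → R) :
    ∑ k : μO, (if k ≤ a then F k else 0) = ∑ k : μO, (if k < a then F k else 0) + F a := by
  have h8 : ∀ k : μO, (if k ≤ a then F k else 0) = (if k < a then F k else 0) + if k = a then F k else 0 := by
    intro k
    rcases lt_trichotomy k a with hk | hk | hk
    · rw [if_pos hk.le, if_pos hk, if_neg hk.ne, add_zero]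
    · subst hk; rw [if_pos le_rfl, if_neg (lt_irrefl _), if_pos rfl, zero_add]
    · rw [if_neg (not_le.2 hk), if_neg (not_lt.2 hk.le), if_neg hk.ne', add_zero]
  simp only [h8, Finset.sum_add_distrib, Finset.sum_ite_eq', Finset.mem_univ, if_true]

/-- `Σ_{a ≤ l} = Σ_{a < l} + (l = a)`. [folklore] -/
private theorem sum_ite_ge_eq (a : μO) (F : μO → R) :
    ∑ l : μO, (if a ≤ l then F l else 0) = ∑ l : μO, (if a < l then F l else 0) + F a := by
  have h8 : ∀ l : μO, (if a ≤ l then F l else 0) = (if a < l then F l else 0) + if a = l then F l else 0 := by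
    intro l
    rcases lt_trichotomy a l with hl | hl | hl
    · rw [if_pos hl.le, if_pos hl, if_neg hl.ne, add_zero]
    · subst hl; rw [if_pos le_rfl, if_neg (lt_irrefl _), if_pos rfl, zero_add]
    · rw [if_neg (not_le.2 hl), if_neg (not_lt.2 hl.le), if_neg hl.ne', add_zero]
  simp only [h8, Finset.sum_add_distrib, Finset.sum_ite_eq, Finset.mem_univ, if_true]

/-- **(C3) the mixed rule, `f ∈ S`, `j ∈ G/S`, `S` a self-energy block inserted right AFTER the path line `a` (the line ENTERING `S`; `χ_a = 1`)**:
`[U²C_fj]_{2n_S} = U_S · (U_S A^S_f) · ((U²C)^{G/S}_{aj} + U_{G/S} · W^{G/S}_{ja})`, `W^{G/S}_{ja} = z_a B′^{G/S}_{ja}` a SINGLE adjacent-line term (gen-02's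
«entering» form). [cite: AoyamaEtAl2006, §3.3 (eq. [C_fj]_UV, f ∈ S, j ∈ G/S, «where i is the line adjacent to S»)] -/
theorem cCof_zero_inl_inr {a : μO} {ηS : μS → ℤ} (hT : PathAdapted TOS TOO a ηS) (hχa : χO a = 1) (hpre : ∀ k, pre k ↔ k ≤ a)
    (f : μS) (j : μO) :
    cCof TI TOS TOO zS zO (fun b => (ηS b : R)) χO pre 0 (Sum.inl f) (Sum.inr j) =
      UDet TI zS * ANum TI zS (fun b => (ηS b : R)) f * (CNum TOO zO χO (· < ·) a j + UDet TOO zO * WNum TOO zO χO j a) := by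
  rw [cCof_zero_inl_inr_pre TI TOS TOO zS zO χO pre hT hχa]
  simp only [hpre, not_le, sum_ite_le_eq]
  ring

/-- **(C3), the block inserted right BEFORE the path line `a` (the line LEAVING `S`; `χ_a = 1`)**:
`[U²C_fj]_{2n_S} = U_S · (U_S A^S_f) · ((U²C)^{G/S}_{aj} − U_{G/S} · W^{G/S}_{ja})` (gen-02's «leaving» form: the same single-line term with the opposite sign).
[cite: AoyamaEtAl2006, §3.3 (eq. [C_fj]_UV, f ∈ S, j ∈ G/S)] -/
theorem cCof_zero_inl_inr' {a : μO} {ηS : μS → ℤ} (hT : PathAdapted TOS TOO a ηS) (hχa : χO a = 1) (hpre : ∀ k, pre k ↔ k < a)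
    (f : μS) (j : μO) :
    cCof TI TOS TOO zS zO (fun b => (ηS b : R)) χO pre 0 (Sum.inl f) (Sum.inr j) =
      UDet TI zS * ANum TI zS (fun b => (ηS b : R)) f * (CNum TOO zO χO (· < ·) a j - UDet TOO zO * WNum TOO zO χO j a) := by
  rw [cCof_zero_inl_inr_pre TI TOS TOO zS zO χO pre hT hχa]
  simp only [hpre, not_lt, sum_ite_ge_eq]
  ring

end UV

end Literature.MathematicalPhysics.QuantumFieldTheory.AoyamaEtAl2006
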